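import Summits.AtomisticToContinuum.HydrodynamicLimit.Theses.PesinPricing

/-!
# Birth skeleton (BC3) for crux `KiferYoungUpperR`
(stmt-AtomisticToContinuum-13790, route `PesinPricing`, rank 3; registrar one-shot 2026-08-17)

Crux (FIXED, imported by name):
`Summit.AtomisticToContinuum.HydrodynamicLimit.Theses.PesinPricing.KiferYoungUpperR` — the Kifer–Young
large-deviation UPPER bound for the particle-rooted space–time local state `R_N(z)` of `N+1` hard spheres on
`𝕋³` under the invariant homogeneous Gibbs law `G_N = localGibbsLaw σ 1 0 θe`, on the conserved energy cut
`𝖤(z) ≤ e₀(N+1)`, at speed `a_N = (N+1)^{4/3}(t₂ − t₁)` (≍ collisions in the window), for EVERY local-weakly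
closed set `𝒜` of laws, with rate `c · inf {infPesinDefect Ψ P : (P, Ψ) ∈ 𝓛(σ,e₀), palmLaw P ∈ 𝒜}`:
`∀ r, ofReal r < inf → ∀ᶠ N, G_N{cut ∧ R_N ∈ 𝒜} ≤ exp(−c·r·a_N)`.

## The cut (Kifer 1990 §2 / Young 1990 Thm 1 covering scheme, in the joint limit)

A large-deviation upper bound for CLOSED sets is assembled from bounds on small OPEN sets plus exponential
tightness (Dembo–Zeitouni Thm 4.1.11 + Lemma 1.2.18 pattern).  Accordingly the crux is cut into the three
children already named in the route's TWO-LAYER PLAN, each stated in the crux's own frame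
(`∃ σ₀ ∀ σ<σ₀ ∀ θe ∀ e₀ [∃ c] ∀ t₁<t₂ ∀ Φ …`, constants uniform in the window and the flow family):

* `stub_localCounting`  (L, HARDEST — LocalCounting + DefectLsc of the plan): LOCAL UPPER BOUND AT CLASS STATES.
  For every `(P, Ψ) ∈ 𝓛(σ,e₀)` and every `r` with `ofReal r < inf_{Ψ' : (P,Ψ') ∈ 𝓛} infPesinDefect Ψ' P` there
  is a local-weak OPEN `𝒰 ∋ palmLaw P` with `∀ᶠ N, G_N{cut ∧ R_N ∈ 𝒰} ≤ exp(−c·r·a_N)`.  Content: Young's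
  separated-set counting of patch histories fed by the N-uniform volume lemma (crux `UpperVolumeLemma`),
  localised in space with `o(1)` boundary entropy per particle, plus lower semicontinuity of the defect along
  visited sequences (entropy density u.s.c., `λ⁺`-density continuous under tempered collisions).
* `stub_limitPointsInClass` (L — LimitPointsInClass of the plan): OFF THE CLASS THE CUT EVENT IS
  SUPER-EXPONENTIALLY NEGLIGIBLE, LOCALLY.  For every law `Q` that is NOT `palmLaw P` of a class pair and every
  `M : ℝ` there is an open `𝒰 ∋ Q` with `∀ᶠ N, G_N{cut ∧ R_N ∈ 𝒰} ≤ exp(−M·a_N)`.  Content: the noiseless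
  Palm analogue of Olla–Varadhan–Yau 1993 Lemmas 4.1–4.3 — root present and root velocity tight from the
  energy cut (no mass loss, intensity `σ³` exact), unit hard core, point-stationarity, asymptotic flow
  stationarity of long time averages, and EXISTENCE of the infinite dynamics on the limit law (Alexander 1976
  is Gibbs-only: the acknowledged risk of this child).
* `stub_expTightness` (M — the compactness input): EXPONENTIAL TIGHTNESS in the local weak topology: for every
  `M` a local-weakly COMPACT `𝒦` with `∀ᶠ N, G_N{cut ∧ R_N ∉ 𝒦} ≤ exp(−M·a_N)`.  Content: unit-hard-core
  configurations form a vaguely compact set (uniformly bounded counts on compact phase windows, no merging),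
  and probability laws carried by a vaguely compact set are local-weakly compact (Riesz–Markov / Prokhorov
  for the vague topology, Kallenberg Thm A2.3, 16.15–16.16); `R_N(z)` is such a law for `G_N`-a.e. `z`.

Composition `KiferYoungUpperR_of` (PROVED below, no `sorry`): `σ₀ := min`, `c` from LocalCounting; given closed
`𝒜` and `ofReal r < inf`, pick `r < r'` with `ofReal r' < inf` (`ENNReal.lt_iff_exists_real_btwn`); take the
compact `𝒦` of ExpTightness at rate `M := c·r'`; every `Q ∈ 𝒜` has an open neighbourhood with eventual bound
`exp(−c·r'·a_N)` (class case: LocalCounting, the crux's infimum over `𝒜 ∩ 𝓛` is below the infimum over the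
dynamics of `P` because `palmLaw P ∈ 𝒜`; off-class case: LimitPointsInClass at `M = c·r'`); `𝒜 ∩ 𝒦` is compact
(`IsCompact.inter_left`), extract a finite subcover (`IsCompact.elim_nhds_subcover`), union bound
(`measure_union_le`, `measure_biUnion_finset_le`): `G_N{cut ∧ R_N ∈ 𝒜} ≤ (1 + #T)·exp(−c·r'·a_N) ≤ exp(−c·r·a_N)`
as soon as `log(1 + #T) ≤ c(r' − r)·a_N`, which holds eventually because `a_N → ∞` (`tendsto_rpow_atTop`).

No stub is the crux or the summit in costume: each is a statement about OPEN neighbourhoods of ONE law (or one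
compact container), none quantifies over closed sets, none carries the crux's infimum over `𝒜`; the BC3 probes
`stub → KiferYoungUpperR`, `stub → HydrodynamicLimit` by `first | exact? | simpa | aesop` fail (registrar notes).
Disproof.lean: none on this crux at registration time (`ledger crux ls`: no workfiles) — nothing to honour yet;
the refuter's typing traps T1–T5 (EVIDENCE.md, stmt-13790) are respected: the class keeps the intensity clause and
allows non-ergodic `P` (T1), rates live in `ℝ≥0∞` with `inf ∅ = ⊤` (T5), no `Real.log` of a measure anywhere.
-/

noncomputable section

open MeasureTheory Filter Topology Set
open scoped ENNReal BigOperators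

namespace Summit.AtomisticToContinuum.HydrodynamicLimit.Cruxes.KiferYoungUpperR.Birth

open Literature.Analysis.FunctionSpaces (PointConfig)
open Literature.Analysis.FunctionSpaces.PointConfig (localWeakTopology IsLocalWeakClosed)
open Summit.AtomisticToContinuum.HydrodynamicLimit.Theses.PesinPricing (KiferYoungUpperR)

/-! ### Vocabulary (abbreviations of the crux's own expressions; no new mathematics) -/

/-- Laws of marked configurations of `ℝ³ × ℝ³` (the crux's `Measure (PointConfig (V3 × V3))`). -/
abbrev Law : Type :=
  Measure (PointConfig (Literature.MathematicalPhysics.KineticTheory.V3 × Literature.MathematicalPhysics.KineticTheory.V3))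

/-- Phase space of `N + 1` spheres on `𝕋³` (the crux's `Config (N + 1) (Fin 3) T3`). -/
abbrev PhaseN (N : ℕ) : Type :=
  Literature.Analysis.FluidPDE.Config (N + 1) (Fin 3) Literature.MathematicalPhysics.KineticTheory.T3

/-- Hard-sphere flows of `N + 1` spheres of diameter `hsDiameter σ N` on `𝕋³` (the crux's flow type). -/
abbrev FlowN (σ : ℝ) (N : ℕ) : Type :=
  Literature.Analysis.FluidPDE.HardSphereFlow (Literature.Analysis.FluidPDE.Torus.geometry (Fin 3))
    (Literature.MathematicalPhysics.KineticTheory.hsDiameter σ N) (N + 1)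

/-- Infinite hard-sphere flows of unit diameter in `d = 3` (the crux's dynamics witnesses `Ψ`). -/
abbrev IFlow : Type :=
  Literature.Analysis.FluidPDE.InfiniteHardSphereFlow (Fin 3) 1

/-- The invariant homogeneous Gibbs law `G_N = localGibbsLaw σ 1 0 θe N Φ` (verbatim the crux's). -/
abbrev gibbsN (σ θe : ℝ) (N : ℕ) (Φ : FlowN σ N) : Measure (PhaseN N) :=
  Literature.MathematicalPhysics.KineticTheory.localGibbsLaw σ (fun _ => 1) (fun _ => 0) (fun _ => θe) N Φ

/-- The energy-cut event meeting a set `𝒰` of laws: `{z | 𝖤(z) ≤ e₀ (N+1) ∧ R_N(z) ∈ 𝒰}` (verbatim the crux's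
event, with `𝒰` for `𝒜`). -/
def cutEvent (σ e₀ : ℝ) (N : ℕ) (Φ : FlowN σ N) (t₁ t₂ : ℝ) (𝒰 : Set Law) : Set (PhaseN N) :=
  {z | (∑ i : Fin (N + 1), ‖(z i).2‖ ^ 2 / 2) ≤ e₀ * ((N : ℝ) + 1) ∧
    Literature.Analysis.FluidPDE.rootedLocalState Φ z t₁ t₂ ∈ 𝒰}

/-- The class `𝓛(σ, e₀)` as a predicate on pairs `(P, Ψ)`: verbatim the conjunction inside the crux's infimum
WITHOUT its last clause `palmLaw P ∈ 𝒜` (probability, translation invariant, intensity `σ³`, unit hard core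
a.s., `Ψ` a.e.-defined and stationary for `P`, Palm root kinetic energy `≤ e₀`). -/
def InClass (σ e₀ : ℝ) (P : Law) (Ψ : IFlow) : Prop :=
  IsProbabilityMeasure P ∧ Literature.Analysis.FluidPDE.IsTranslationInvariant P ∧
    Literature.Analysis.FluidPDE.intensity P = ENNReal.ofReal (σ ^ 3) ∧
    (∀ᵐ ω ∂P, Literature.Analysis.FluidPDE.IsHardCore 1 ω) ∧ Ψ.IsAEDefined P ∧ Ψ.IsStationary P ∧
    ∫⁻ ω, Literature.Analysis.FluidPDE.rootKineticEnergy ω ∂(Literature.Analysis.FluidPDE.palmLaw P) ≤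
      ENNReal.ofReal e₀

/-! ### The three stub statements (named `Prop`s) -/

/-- LOCAL COUNTING (LocalCounting + DefectLsc of the route's two-layer plan; the hardest stub): the local
large-deviation upper bound AT A CLASS STATE with the Pesin-defect rate.  `c = c(σ, θe, e₀)` is chosen before
the window, the flow family and the state; the open neighbourhood and the threshold in `N` may depend on
everything. [cite: Young1990, Thm 1] [cite: Kifer1990, §2] -/
def LocalCounting : Prop :=
  ∃ σ₀ : ℝ, 0 < σ₀ ∧ ∀ σ : ℝ, 0 < σ → σ < σ₀ → ∀ θe : ℝ, 0 < θe → ∀ e₀ : ℝ, 0 < e₀ →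
    ∃ c : ℝ, 0 < c ∧ ∀ t₁ t₂ : ℝ, t₁ < t₂ → ∀ (Φ : (N : ℕ) → FlowN σ N) (P : Law) (Ψ : IFlow),
      InClass σ e₀ P Ψ →
        ∀ r : ℝ, ENNReal.ofReal r <
            (⨅ (Ψ' : IFlow) (_ : InClass σ e₀ P Ψ'), Literature.Dynamics.Billiards.infPesinDefect Ψ' P) →
          ∃ 𝒰 : Set Law, IsOpen[localWeakTopology] 𝒰 ∧ Literature.Analysis.FluidPDE.palmLaw P ∈ 𝒰 ∧
            ∀ᶠ N : ℕ in atTop,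
              gibbsN σ θe N (Φ N) (cutEvent σ e₀ N (Φ N) t₁ t₂ 𝒰) ≤
                ENNReal.ofReal (Real.exp (-(c * r * ((N : ℝ) + 1) ^ (4 / 3 : ℝ) * (t₂ - t₁))))

/-- LIMIT POINTS IN CLASS (route plan, third child): away from the Palm image of the class the cut event is
locally super-exponentially negligible at speed `a_N` — every law `Q` that is not `palmLaw P` of a class pair
has, for every `M`, an open neighbourhood visited with probability `≤ exp(−M a_N)` eventually.  (For `M ≤ 0`
the bound is the trivial one for the probability law `G_N`.) [cite: OllaVaradhanYau1993, §4 Lemmas 4.1–4.3]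
[cite: Alexander1976] -/
def LimitPointsInClass : Prop :=
  ∃ σ₀ : ℝ, 0 < σ₀ ∧ ∀ σ : ℝ, 0 < σ → σ < σ₀ → ∀ θe : ℝ, 0 < θe → ∀ e₀ : ℝ, 0 < e₀ →
    ∀ t₁ t₂ : ℝ, t₁ < t₂ → ∀ (Φ : (N : ℕ) → FlowN σ N) (Q : Law),
      (¬ ∃ (P : Law) (Ψ : IFlow), InClass σ e₀ P Ψ ∧ Literature.Analysis.FluidPDE.palmLaw P = Q) →
        ∀ M : ℝ, ∃ 𝒰 : Set Law, IsOpen[localWeakTopology] 𝒰 ∧ Q ∈ 𝒰 ∧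
          ∀ᶠ N : ℕ in atTop,
            gibbsN σ θe N (Φ N) (cutEvent σ e₀ N (Φ N) t₁ t₂ 𝒰) ≤
              ENNReal.ofReal (Real.exp (-(M * ((N : ℝ) + 1) ^ (4 / 3 : ℝ) * (t₂ - t₁))))

/-- EXPONENTIAL TIGHTNESS in the local weak topology: for every rate `M` a local-weakly compact set of laws
outside which the cut event has probability `≤ exp(−M a_N)` eventually (expected with `𝒦` = probability laws
carried by unit-hard-core configurations and an EMPTY exceptional event: vague compactness of hard-core
configurations + weak compactness of the laws they carry). [cite: Kallenberg2021, Thm. A2.3, Thm. 16.16]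
[cite: OllaVaradhanYau1993, Lemma 4.1] -/
def ExpTightness : Prop :=
  ∃ σ₀ : ℝ, 0 < σ₀ ∧ ∀ σ : ℝ, 0 < σ → σ < σ₀ → ∀ θe : ℝ, 0 < θe → ∀ e₀ : ℝ, 0 < e₀ →
    ∀ t₁ t₂ : ℝ, t₁ < t₂ → ∀ (Φ : (N : ℕ) → FlowN σ N) (M : ℝ),
      ∃ 𝒦 : Set Law, @IsCompact Law localWeakTopology 𝒦 ∧
        ∀ᶠ N : ℕ in atTop,
          gibbsN σ θe N (Φ N) (cutEvent σ e₀ N (Φ N) t₁ t₂ 𝒦ᶜ) ≤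
            ENNReal.ofReal (Real.exp (-(M * ((N : ℝ) + 1) ^ (4 / 3 : ℝ) * (t₂ - t₁))))

/-! ### Registered stubs (the open obligations of the line; `sorry` only here) -/

/-- STUB 1 (L; HARDEST — volume lemma → localised separated-set counting → semicontinuity of the defect). -/
theorem stub_localCounting : LocalCounting := by
  sorry

/-- STUB 2 (L — limit points of the cut-event rooted states are Palm laws of class states, locally
super-exponentially surely; incl. existence of the infinite dynamics on the limit law). -/
theorem stub_limitPointsInClass : LimitPointsInClass := by
  sorry

/-- STUB 3 (M — exponential tightness: hard-core laws live in a local-weakly compact set). -/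
theorem stub_expTightness : ExpTightness := by
  sorry

/-! ### Name-keyed aliases of the stub statements (the hypotheses of the composition; the skeleton audit
admits a hypothesis only if its head constant is a registered obligation or is named like a declared stub) -/
namespace Registered

/-- Alias of `LocalCounting` keyed by the registered stub name. -/
abbrev stub_localCounting : Prop := LocalCounting
/-- Alias of `LimitPointsInClass` keyed by the registered stub name. -/
abbrev stub_limitPointsInClass : Prop := LimitPointsInClass
/-- Alias of `ExpTightness` keyed by the registered stub name. -/
abbrev stub_expTightness : Prop := ExpTightness

end Registered

/-! ### Glue lemmas (PROVED) -/

/-- Room in the rate: below an `ℝ≥0∞` infimum there is always a strictly larger real still below it. -/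
theorem exists_real_btwn {r : ℝ} {I : ℝ≥0∞} (h : ENNReal.ofReal r < I) :
    ∃ r' : ℝ, r < r' ∧ ENNReal.ofReal r' < I := by
  obtain ⟨q, -, hrq, hqI⟩ := ENNReal.lt_iff_exists_real_btwn.1 h
  refine ⟨q, ?_, hqI⟩
  by_contra hqr
  exact absurd hrq (not_lt.2 (ENNReal.ofReal_le_ofReal (not_lt.1 hqr)))

/-- The speed `a_N = (N+1)^{4/3}(t₂ − t₁)` tends to infinity, with any positive prefactor. -/
theorem tendsto_speed {κ t₁ t₂ : ℝ} (hκ : 0 < κ) (ht : t₁ < t₂) :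
    Tendsto (fun N : ℕ => κ * ((N : ℝ) + 1) ^ (4 / 3 : ℝ) * (t₂ - t₁)) atTop atTop := by
  have h0 : Tendsto (fun N : ℕ => (N : ℝ) + 1) atTop atTop :=
    tendsto_atTop_add_const_right _ _ tendsto_natCast_atTop_atTop
  have h1 : Tendsto (fun N : ℕ => ((N : ℝ) + 1) ^ (4 / 3 : ℝ)) atTop atTop :=
    (tendsto_rpow_atTop (by norm_num)).comp h0
  exact (h1.const_mul_atTop hκ).atTop_mul_const (sub_pos.2 ht)

/-- The real-number bookkeeping of the union bound (`a = X·D`): `(1 + m)·e^{−c r' a} ≤ e^{−c r a}` once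
`log (1 + m) ≤ c (r' − r) a`. -/
theorem union_bound_real {m c r r' X D : ℝ} (hm : 0 ≤ m)
    (hlog : Real.log (1 + m) ≤ c * (r' - r) * X * D) :
    (1 + m) * Real.exp (-(c * r' * X * D)) ≤ Real.exp (-(c * r * X * D)) := by
  have hpos : 0 < 1 + m := by linarith
  calc (1 + m) * Real.exp (-(c * r' * X * D))
      = Real.exp (Real.log (1 + m)) * Real.exp (-(c * r' * X * D)) := by rw [Real.exp_log hpos]
    _ ≤ Real.exp (c * (r' - r) * X * D) * Real.exp (-(c * r' * X * D)) :=
        mul_le_mul_of_nonneg_right (Real.exp_le_exp.2 hlog) (Real.exp_pos _).le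
    _ = Real.exp (-(c * r * X * D)) := by rw [← Real.exp_add]; congr 1; ring

/-- The same bookkeeping in `ℝ≥0∞`: `ofReal e + m·ofReal e ≤ ofReal b` from `(1 + m)·e ≤ b`. -/
theorem union_bound_ennreal {e m b : ℝ} (he : 0 ≤ e) (hm : 0 ≤ m) (h : (1 + m) * e ≤ b) :
    ENNReal.ofReal e + ENNReal.ofReal m * ENNReal.ofReal e ≤ ENNReal.ofReal b := by
  rw [← ENNReal.ofReal_mul hm, ← ENNReal.ofReal_add he (mul_nonneg hm he)]
  exact ENNReal.ofReal_le_ofReal (by nlinarith)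

/-! ### The composition: the three stubs imply the crux BY NAME -/

/-- **The line concludes the crux BY NAME** (Kifer–Young covering argument; no `sorry`):
LocalCounting → LimitPointsInClass → ExpTightness →
`Summit.AtomisticToContinuum.HydrodynamicLimit.Theses.PesinPricing.KiferYoungUpperR`. -/
theorem KiferYoungUpperR_of (h₁ : Registered.stub_localCounting) (h₂ : Registered.stub_limitPointsInClass)
    (h₃ : Registered.stub_expTightness) : KiferYoungUpperR := by
  obtain ⟨σ₁, hσ₁, H₁⟩ := h₁
  obtain ⟨σ₂, hσ₂, H₂⟩ := h₂
  obtain ⟨σ₃, hσ₃, H₃⟩ := h₃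
  refine ⟨min σ₁ (min σ₂ σ₃), lt_min hσ₁ (lt_min hσ₂ hσ₃), ?_⟩
  intro σ hσ hσlt θe hθe e₀ he₀
  have hσ1 : σ < σ₁ := lt_of_lt_of_le hσlt (min_le_left _ _)
  have hσ2 : σ < σ₂ := lt_of_lt_of_le hσlt ((min_le_right _ _).trans (min_le_left _ _))
  have hσ3 : σ < σ₃ := lt_of_lt_of_le hσlt ((min_le_right _ _).trans (min_le_right _ _))
  obtain ⟨c, hc, Hc⟩ := H₁ σ hσ hσ1 θe hθe e₀ he₀
  refine ⟨c, hc, ?_⟩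
  intro t₁ t₂ ht Φ 𝒜 h𝒜 r hr
  letI : TopologicalSpace Law := localWeakTopology
  -- (0) room in the rate
  obtain ⟨r', hrr', hr'⟩ := exists_real_btwn hr
  -- (1) every law of `𝒜` has an open neighbourhood with the eventual bound at rate `c r'`
  have key : ∀ Q ∈ 𝒜, ∃ 𝒰 : Set Law, IsOpen 𝒰 ∧ Q ∈ 𝒰 ∧ ∀ᶠ N : ℕ in atTop,
      gibbsN σ θe N (Φ N) (cutEvent σ e₀ N (Φ N) t₁ t₂ 𝒰) ≤
        ENNReal.ofReal (Real.exp (-(c * r' * ((N : ℝ) + 1) ^ (4 / 3 : ℝ) * (t₂ - t₁)))) := by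
    intro Q hQ
    by_cases hcl : ∃ (P : Law) (Ψ : IFlow), InClass σ e₀ P Ψ ∧ Literature.Analysis.FluidPDE.palmLaw P = Q
    · obtain ⟨P, Ψ, hPΨ, rfl⟩ := hcl
      refine Hc t₁ t₂ ht Φ P Ψ hPΨ r' (hr'.trans_le ?_)
      refine le_iInf₂ fun Ψ' hΨ' => ?_
      obtain ⟨hA, hB, hC, hD, hE, hF, hG⟩ := hΨ'
      exact iInf_le_of_le P <| iInf_le_of_le Ψ' <| iInf_le _ ⟨hA, hB, hC, hD, hE, hF, hG, hQ⟩
    · exact H₂ σ hσ hσ2 θe hθe e₀ he₀ t₁ t₂ ht Φ Q hcl (c * r')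
  choose! U hU using key
  -- (2) exponential tightness at rate `c r'`
  obtain ⟨𝒦, h𝒦, h𝒦ev⟩ := H₃ σ hσ hσ3 θe hθe e₀ he₀ t₁ t₂ ht Φ (c * r')
  -- (3) a finite subcover of the compact set `𝒜 ∩ 𝒦`
  have hcpt : IsCompact (𝒜 ∩ 𝒦) := h𝒦.inter_left h𝒜
  obtain ⟨T, hT𝒜, hTcov⟩ :=
    hcpt.elim_nhds_subcover U fun Q hQ => (hU Q hQ.1).1.mem_nhds (hU Q hQ.1).2.1
  -- (4) the eventual estimates, all at once
  have hTev : ∀ᶠ N : ℕ in atTop, ∀ Q ∈ T,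
      gibbsN σ θe N (Φ N) (cutEvent σ e₀ N (Φ N) t₁ t₂ (U Q)) ≤
        ENNReal.ofReal (Real.exp (-(c * r' * ((N : ℝ) + 1) ^ (4 / 3 : ℝ) * (t₂ - t₁)))) :=
    (Filter.eventually_all_finset T).2 fun Q hQ => (hU Q (hT𝒜 Q hQ).1).2.2
  have hlog : ∀ᶠ N : ℕ in atTop,
      Real.log (1 + (T.card : ℝ)) ≤ c * (r' - r) * ((N : ℝ) + 1) ^ (4 / 3 : ℝ) * (t₂ - t₁) :=
    (tendsto_speed (mul_pos hc (sub_pos.2 hrr')) ht).eventually_ge_atTop _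
  filter_upwards [h𝒦ev, hTev, hlog] with N hN𝒦 hNT hNlog
  -- (5) the covering: cut ∧ R_N ∈ 𝒜 ⊆ (cut ∧ R_N ∉ 𝒦) ∪ ⋃_{Q ∈ T} (cut ∧ R_N ∈ U Q)
  have hsub : cutEvent σ e₀ N (Φ N) t₁ t₂ 𝒜 ⊆
      cutEvent σ e₀ N (Φ N) t₁ t₂ 𝒦ᶜ ∪ ⋃ Q ∈ T, cutEvent σ e₀ N (Φ N) t₁ t₂ (U Q) := by
    rintro z ⟨hzE, hz𝒜⟩
    by_cases hz𝒦 : Literature.Analysis.FluidPDE.rootedLocalState (Φ N) z t₁ t₂ ∈ 𝒦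
    · obtain ⟨Q, hQT, hzQ⟩ := Set.mem_iUnion₂.1 (hTcov ⟨hz𝒜, hz𝒦⟩)
      exact Or.inr (Set.mem_iUnion₂.2 ⟨Q, hQT, hzE, hzQ⟩)
    · exact Or.inl ⟨hzE, hz𝒦⟩
  -- (6) the union bound and the bookkeeping
  have hreal := union_bound_real (Nat.cast_nonneg T.card) hNlog
  show gibbsN σ θe N (Φ N) (cutEvent σ e₀ N (Φ N) t₁ t₂ 𝒜) ≤ _
  calc gibbsN σ θe N (Φ N) (cutEvent σ e₀ N (Φ N) t₁ t₂ 𝒜)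
      ≤ gibbsN σ θe N (Φ N)
          (cutEvent σ e₀ N (Φ N) t₁ t₂ 𝒦ᶜ ∪ ⋃ Q ∈ T, cutEvent σ e₀ N (Φ N) t₁ t₂ (U Q)) :=
        measure_mono hsub
    _ ≤ gibbsN σ θe N (Φ N) (cutEvent σ e₀ N (Φ N) t₁ t₂ 𝒦ᶜ) +
          gibbsN σ θe N (Φ N) (⋃ Q ∈ T, cutEvent σ e₀ N (Φ N) t₁ t₂ (U Q)) :=
        measure_union_le _ _
    _ ≤ gibbsN σ θe N (Φ N) (cutEvent σ e₀ N (Φ N) t₁ t₂ 𝒦ᶜ) +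
          ∑ Q ∈ T, gibbsN σ θe N (Φ N) (cutEvent σ e₀ N (Φ N) t₁ t₂ (U Q)) :=
        add_le_add le_rfl (measure_biUnion_finset_le _ _)
    _ ≤ ENNReal.ofReal (Real.exp (-(c * r' * ((N : ℝ) + 1) ^ (4 / 3 : ℝ) * (t₂ - t₁)))) +
          ∑ Q ∈ T, ENNReal.ofReal (Real.exp (-(c * r' * ((N : ℝ) + 1) ^ (4 / 3 : ℝ) * (t₂ - t₁)))) :=
        add_le_add hN𝒦 (Finset.sum_le_sum fun Q hQ => hNT Q hQ)
    _ = ENNReal.ofReal (Real.exp (-(c * r' * ((N : ℝ) + 1) ^ (4 / 3 : ℝ) * (t₂ - t₁)))) +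
          ENNReal.ofReal (T.card : ℝ) *
            ENNReal.ofReal (Real.exp (-(c * r' * ((N : ℝ) + 1) ^ (4 / 3 : ℝ) * (t₂ - t₁)))) := by
        rw [Finset.sum_const, nsmul_eq_mul, ENNReal.ofReal_natCast]
    _ ≤ ENNReal.ofReal (Real.exp (-(c * r * ((N : ℝ) + 1) ^ (4 / 3 : ℝ) * (t₂ - t₁)))) :=
        union_bound_ennreal (Real.exp_pos _).le (Nat.cast_nonneg _) hreal

/-- Wiring check: the registered stubs feed `KiferYoungUpperR_of` as stated. -/
example : KiferYoungUpperR :=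
  KiferYoungUpperR_of stub_localCounting stub_limitPointsInClass stub_expTightness

end Summit.AtomisticToContinuum.HydrodynamicLimit.Cruxes.KiferYoungUpperR.Birth

end
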